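import Literature.Analysis.ODE.LinearObservability
import Literature.Analysis.ODE.LinearVolterraDuality
import Mathlib.LinearAlgebra.Charpoly.Basic
import HarnessLib

/-!
# Bond–heat uncertainty window, part U-a1: the graded Krylov curve of a linear output

Cell `decomp-a2c`, lineage crux `ExtensiveSnapshotIrreversibility` (K_fix half, leaf S3
`KernelTemperatureLipschitz`), HARMONIC CALIBRATION of the skeleton-weight leaf (SWM)
`SkeletonWeightMoments` (part R): the exponent `s^{-1/2}` of the regularised Malliavin weight of the
harmonic chain comes from ONE finite-dimensional fact (part U-a2, `sq_output_le_div_mul_integral`: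
`(C X)² ≤ (K/s) ∫₀ˢ (C exp(tM) X)² dt` for ANY `M : E →L[ℝ] E`, `C : E →L[ℝ] ℝ`, `E`
finite-dimensional, `s ∈ (0, 1]`).  This file prepares it: after the rescaling `t = s u` the graded
Krylov coordinates `Z_k(u) = s^k C M^k exp(us M) X`, `k < finrank E`, solve `Ż = (S + s R_s) Z`
with the nilpotent SHIFT `S` and a last-row perturbation `R_s` bounded uniformly in `s ≤ 1`
(Cayley–Hamilton), and the shift is observable from its first coordinate
(`exists_observabilityConstant` of `LinearObservability.lean`).

Sections: §1 the shift system on `Fin n → ℝ` (`shiftCLM`, `lastRowCLM`, observability of the shift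
from coordinate `0`); §2 Cayley–Hamilton for powers of a continuous linear map; §3 the graded
Krylov curve, its derivative and its integral equation, the last-row bound.

References: E. D. Sontag, *Mathematical Control Theory* (1998), §6.2 (observability Gramians);
the `1/s` sampling rate for quasi-polynomials is folklore (Turán-type lemmas, e.g. F. L. Nazarov,
*Local estimates for exponential polynomials*, Algebra i Analiz 5 (1993)); here only the soft
compactness version is needed. [folklore]
-/

noncomputable section

namespace Summit.AtomisticToContinuum.FouriersLaw.Theorems.ExtensiveSnapshotIrreversibility.EnergyWindow

open MeasureTheory Set Filter Topology NormedSpace Finset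
open Literature.Analysis.ODE

/-! ## 1. The shift system on `Fin n → ℝ` -/

section Shift

variable (n : ℕ)

/-- The left shift `(S z)_k = z_{k+1}` (and `0` in the last slot) on `Fin n → ℝ`. [folklore] -/
def shiftCLM : (Fin n → ℝ) →L[ℝ] (Fin n → ℝ) :=
  ContinuousLinearMap.pi fun k : Fin n =>
    if h : k.val + 1 < n then
      ContinuousLinearMap.proj (R := ℝ) (φ := fun _ : Fin n => ℝ) ⟨k.val + 1, h⟩ else 0

/-- Unfolding `shiftCLM`. [folklore] -/
theorem shiftCLM_apply (z : Fin n → ℝ) (k : Fin n) :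
    shiftCLM n z k = if h : k.val + 1 < n then z ⟨k.val + 1, h⟩ else 0 := by
  unfold shiftCLM
  rw [ContinuousLinearMap.pi_apply]
  split_ifs <;> rfl

/-- Powers of the shift read off later coordinates: `(S^j z)_k = z_{k+j}` (or `0`). [folklore] -/
theorem shiftCLM_pow_apply (z : Fin n → ℝ) (j : ℕ) (k : Fin n) :
    ((shiftCLM n) ^ j) z k = if h : k.val + j < n then z ⟨k.val + j, h⟩ else 0 := by
  induction j generalizing z k with
  | zero => simp
  | succ j ih =>
    rw [pow_succ]
    change ((shiftCLM n) ^ j) (shiftCLM n z) k = _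
    rw [ih (shiftCLM n z) k]
    by_cases h1 : k.val + (j + 1) < n
    · have h2 : k.val + j < n := by omega
      rw [dif_pos h2, dif_pos h1, shiftCLM_apply]
      have h3 : (⟨k.val + j, h2⟩ : Fin n).val + 1 < n := by simp only; omega
      rw [dif_pos h3]
      congr 1
    · rw [dif_neg h1]
      by_cases h2 : k.val + j < n
      · rw [dif_pos h2, shiftCLM_apply]
        have h3 : ¬ ((⟨k.val + j, h2⟩ : Fin n).val + 1 < n) := by simp only; omega
        rw [dif_neg h3]
      · rw [dif_neg h2]

/-- The functional `z ↦ Σ_j w_j z_j`. [folklore] -/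
def dotCLM (w : Fin n → ℝ) : (Fin n → ℝ) →L[ℝ] ℝ :=
  ∑ j, w j • ContinuousLinearMap.proj (R := ℝ) (φ := fun _ : Fin n => ℝ) j

/-- Unfolding `dotCLM`. [folklore] -/
theorem dotCLM_apply (w z : Fin n → ℝ) : dotCLM n w z = ∑ j, w j * z j := by
  simp [dotCLM]

/-- The last-row operator `z ↦ (0, …, 0, Σ_j w_j z_j)`. [folklore] -/
def lastRowCLM (w : Fin n → ℝ) : (Fin n → ℝ) →L[ℝ] (Fin n → ℝ) :=
  ContinuousLinearMap.pi fun k : Fin n => if k.val + 1 = n then dotCLM n w else 0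

/-- Unfolding `lastRowCLM`. [folklore] -/
theorem lastRowCLM_apply (w z : Fin n → ℝ) (k : Fin n) :
    lastRowCLM n w z k = if k.val + 1 = n then ∑ j, w j * z j else 0 := by
  unfold lastRowCLM
  rw [ContinuousLinearMap.pi_apply]
  split_ifs
  · exact dotCLM_apply n w z
  · rfl

/-- `‖last-row operator‖ ≤ Σ_j |w_j|` (sup norm). [folklore] -/
theorem norm_lastRowCLM_le (w : Fin n → ℝ) : ‖lastRowCLM n w‖ ≤ ∑ j, |w j| := by
  refine ContinuousLinearMap.opNorm_le_bound _ (by positivity) fun z => ?_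
  rw [pi_norm_le_iff_of_nonneg (by positivity)]
  intro k
  rw [lastRowCLM_apply]
  split_ifs
  · calc ‖∑ j, w j * z j‖ ≤ ∑ j, ‖w j * z j‖ := norm_sum_le _ _
      _ = ∑ j, |w j| * ‖z j‖ := by simp [Real.norm_eq_abs]
      _ ≤ ∑ j, |w j| * ‖z‖ :=
          sum_le_sum fun j _ => mul_le_mul_of_nonneg_left (norm_le_pi_norm z j) (abs_nonneg _)
      _ = (∑ j, |w j|) * ‖z‖ := by rw [Finset.sum_mul]
  · rw [norm_zero]
    positivity

/-- **The shift is observable from its first coordinate**: if `(exp(tS) z)_0 = Σ_k z_k t^k/k!`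
vanishes on `[0, 1]` then `z = 0`. [folklore] -/
theorem eq_zero_of_shift_output_eq_zero (hn : 0 < n) (z : Fin n → ℝ)
    (h : ∀ t ∈ Icc (0 : ℝ) 1, (exp (t • shiftCLM n) z) ⟨0, hn⟩ = 0) : z = 0 := by
  have hk := forall_apply_pow_eq_zero_of_exp
    (ContinuousLinearMap.proj (R := ℝ) (φ := fun _ : Fin n => ℝ) ⟨0, hn⟩) (shiftCLM n) z
    (fun t ht => by rw [ContinuousLinearMap.proj_apply]; exact h t ht)
  funext k
  have h1 := hk k.val
  rw [ContinuousLinearMap.proj_apply, shiftCLM_pow_apply] at h1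
  have h2 : (⟨0, hn⟩ : Fin n).val + k.val < n := by simp
  rw [dif_pos h2] at h1
  have h3 : (⟨(⟨0, hn⟩ : Fin n).val + k.val, h2⟩ : Fin n) = k := Fin.ext (by simp)
  rw [h3] at h1
  exact h1

/-- **Observability constant of the shift**: `∫₀¹ (exp(tS) z)_0² dt ≥ c ‖z‖²` for one `c > 0`.
[folklore] -/
theorem exists_shift_observabilityConstant (hn : 0 < n) : ∃ c : ℝ, 0 < c ∧ ∀ z : Fin n → ℝ,
    c * ‖z‖ ^ 2 ≤ ∫ t in (0 : ℝ)..1, ((exp (t • shiftCLM n) z) ⟨0, hn⟩) ^ 2 := by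
  have h := exists_observabilityConstant (shiftCLM n)
    (ContinuousLinearMap.proj (R := ℝ) (φ := fun _ : Fin n => ℝ) ⟨0, hn⟩) one_pos
    (fun z hz => eq_zero_of_shift_output_eq_zero n hn z
      (fun t ht => by rw [← ContinuousLinearMap.proj_apply (R := ℝ) (φ := fun _ : Fin n => ℝ)
        ⟨0, hn⟩ (exp (t • shiftCLM n) z)]; exact hz t ht))
  simpa only [ContinuousLinearMap.proj_apply] using h

end Shift

/-! ## 2. Cayley–Hamilton for the powers of a continuous linear map -/

section CayleyHamilton

variable {E : Type*} [NormedAddCommGroup E] [NormedSpace ℝ E] [FiniteDimensional ℝ E]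

omit [FiniteDimensional ℝ E] in
/-- Powers of a continuous linear map act as the powers of the underlying linear map.
[folklore] -/
theorem clm_pow_apply_eq (M : E →L[ℝ] E) (k : ℕ) (X : E) :
    (M ^ k) X = ((M : E →ₗ[ℝ] E) ^ k) X := by
  rw [← ContinuousLinearMap.coe_pow]
  rfl

/-- **Cayley–Hamilton**: `M^n X = -Σ_{i<n} a_i M^i X` with `n = finrank E` and `a_i` the
coefficients of the characteristic polynomial of `M`. [folklore] -/
theorem pow_finrank_apply_eq_neg_sum (M : E →L[ℝ] E) (X : E) :
    (M ^ Module.finrank ℝ E) X =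
      -∑ i ∈ Finset.range (Module.finrank ℝ E),
        ((M : E →ₗ[ℝ] E).charpoly.coeff i) • (M ^ i) X := by
  set f : Module.End ℝ E := (M : E →ₗ[ℝ] E) with hf
  have hmon := f.charpoly_monic
  have hdeg : f.charpoly.natDegree = Module.finrank ℝ E := f.charpoly_natDegree
  have h0 := f.aeval_self_charpoly
  rw [hmon.as_sum, hdeg] at h0
  simp only [map_add, map_pow, Polynomial.aeval_X, map_sum, map_mul, Polynomial.aeval_C] at h0
  have h1 := congrArg (fun g : Module.End ℝ E => g X) h0
  simp only [LinearMap.add_apply, LinearMap.zero_apply, LinearMap.coe_sum, Finset.sum_apply,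
    Module.End.mul_apply, Module.algebraMap_end_apply] at h1
  simp only [clm_pow_apply_eq]
  exact eq_neg_of_add_eq_zero_left h1

end CayleyHamilton


/-! ## 3. The graded Krylov curve of an output -/

section Krylov

variable {E : Type*} [NormedAddCommGroup E] [NormedSpace ℝ E] [CompleteSpace E]
  [FiniteDimensional ℝ E] (M : E →L[ℝ] E) (C : E →L[ℝ] ℝ)

/-- The coefficients `a_i` of the characteristic polynomial of `M`. [folklore] -/
def charCoeff (i : ℕ) : ℝ := (M : E →ₗ[ℝ] E).charpoly.coeff i

/-- The graded Krylov curve `Z_k(t) = s^k · C M^k exp(t·sM) X`, `k < finrank E`, of the output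
`C` along the time-rescaled flow of `M`. [folklore] -/
def krylovCurve (s : ℝ) (X : E) (t : ℝ) : Fin (Module.finrank ℝ E) → ℝ :=
  fun k => s ^ (k : ℕ) * C ((M ^ (k : ℕ)) (exp (t • (s • M)) X))

/-- The last-row weights `w_i = -a_i s^{n-i}` of the graded companion matrix. [folklore] -/
def krylovWeights (s : ℝ) : Fin (Module.finrank ℝ E) → ℝ :=
  fun i => -(charCoeff M i) * s ^ (Module.finrank ℝ E - i)

/-- The graded companion generator `G_s = S + (last row w(s))`. [folklore] -/
def krylovGen (s : ℝ) :
    (Fin (Module.finrank ℝ E) → ℝ) →L[ℝ] (Fin (Module.finrank ℝ E) → ℝ) :=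
  shiftCLM (Module.finrank ℝ E) + lastRowCLM (Module.finrank ℝ E) (krylovWeights M s)

omit [CompleteSpace E] [FiniteDimensional ℝ E] in
/-- The first Krylov coordinate is the output itself. [folklore] -/
theorem krylovCurve_zero_apply (hn : 0 < Module.finrank ℝ E) (s : ℝ) (X : E) (t : ℝ) :
    krylovCurve M C s X t ⟨0, hn⟩ = C (exp (t • (s • M)) X) := by
  simp [krylovCurve]

omit [CompleteSpace E] [FiniteDimensional ℝ E] in
/-- … and at time `0` it is `C X`. [folklore] -/
theorem krylovCurve_apply_zero_zero (hn : 0 < Module.finrank ℝ E) (s : ℝ) (X : E) :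
    krylovCurve M C s X 0 ⟨0, hn⟩ = C X := by
  rw [krylovCurve_zero_apply, zero_smul, exp_zero]
  rfl

omit [FiniteDimensional ℝ E] in
/-- Coordinatewise derivative of the Krylov curve: `Ż_k = s^{k+1} C M^{k+1} exp(t sM) X`.
[folklore] -/
theorem hasDerivAt_krylovCurve_apply (s : ℝ) (X : E) (t : ℝ)
    (k : Fin (Module.finrank ℝ E)) :
    HasDerivAt (fun u => krylovCurve M C s X u k)
      (s ^ ((k : ℕ) + 1) * C ((M ^ ((k : ℕ) + 1)) (exp (t • (s • M)) X))) t := by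
  have h1 := (((C.comp (M ^ (k : ℕ))).hasFDerivAt.comp_hasDerivAt t
    (hasDerivAt_linearFlow (s • M) X t))).const_mul (s ^ (k : ℕ))
  have h3 : s ^ (k : ℕ) * ((C.comp (M ^ (k : ℕ))) ((s • M) (exp (t • (s • M)) X)))
      = s ^ ((k : ℕ) + 1) * C ((M ^ ((k : ℕ) + 1)) (exp (t • (s • M)) X)) := by
    rw [ContinuousLinearMap.comp_apply, FunLike.coe_smul, Pi.smul_apply, map_smul,
      map_smul, smul_eq_mul, pow_succ, pow_succ]
    change s ^ (k : ℕ) * (s * C ((M ^ (k : ℕ) * M) (exp (t • (s • M)) X))) = _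
    ring
  rw [h3] at h1
  exact h1

/-- **The companion ODE** `Ż = G_s Z` of the graded Krylov curve (Cayley–Hamilton in the last
row). [folklore] -/
theorem hasDerivAt_krylovCurve (s : ℝ) (X : E) (t : ℝ) :
    HasDerivAt (krylovCurve M C s X) (krylovGen M s (krylovCurve M C s X t)) t := by
  rw [hasDerivAt_pi]
  intro k
  have hk := hasDerivAt_krylovCurve_apply M C s X t k
  suffices hval : krylovGen M s (krylovCurve M C s X t) k
      = s ^ ((k : ℕ) + 1) * C ((M ^ ((k : ℕ) + 1)) (exp (t • (s • M)) X)) by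
    rw [hval]; exact hk
  rw [krylovGen, FunLike.coe_add, Pi.add_apply, Pi.add_apply, shiftCLM_apply,
    lastRowCLM_apply]
  by_cases h : (k : ℕ) + 1 < Module.finrank ℝ E
  · rw [dif_pos h, if_neg (ne_of_lt h), add_zero]
    rfl
  · have hk1 : (k : ℕ) + 1 = Module.finrank ℝ E := by have := k.isLt; omega
    rw [dif_neg h, if_pos hk1, zero_add]
    have hCH := pow_finrank_apply_eq_neg_sum M (exp (t • (s • M)) X)
    rw [hk1, hCH, map_neg, map_sum]
    simp only [map_smul, smul_eq_mul]
    rw [Finset.sum_range (fun i => (M : E →ₗ[ℝ] E).charpoly.coeff i *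
      C ((M ^ i) (exp (t • (s • M)) X))), mul_neg, Finset.mul_sum, ← Finset.sum_neg_distrib]
    refine Finset.sum_congr rfl fun i _ => ?_
    simp only [krylovWeights, krylovCurve, charCoeff]
    rw [← pow_sub_mul_pow s (le_of_lt i.isLt)]
    ring

omit [FiniteDimensional ℝ E] in
/-- The Krylov curve is continuous. [folklore] -/
theorem continuous_krylovCurve (s : ℝ) (X : E) : Continuous (krylovCurve M C s X) :=
  continuous_pi fun k => continuous_const.mul
    (C.continuous.comp ((M ^ (k : ℕ)).continuous.comp (continuous_linearFlow (s • M) X)))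

/-- The Krylov curve solves the integral equation of its companion ODE. [folklore] -/
theorem krylovCurve_eq_add_integral (s : ℝ) (X : E) (t : ℝ) :
    krylovCurve M C s X t =
      krylovCurve M C s X 0 + ∫ u in (0 : ℝ)..t, krylovGen M s (krylovCurve M C s X u) := by
  have hcont : Continuous fun u => krylovGen M s (krylovCurve M C s X u) :=
    (krylovGen M s).continuous.comp (continuous_krylovCurve M C s X)
  rw [intervalIntegral.integral_eq_sub_of_hasDerivAt
    (fun u _ => hasDerivAt_krylovCurve M C s X u) (hcont.intervalIntegrable _ _)]
  abel

omit [CompleteSpace E] in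
/-- The last-row perturbation is `O(s)` for `s ∈ [0, 1]`. [folklore] -/
theorem norm_lastRow_krylovWeights_le {s : ℝ} (hs : 0 ≤ s) (hs1 : s ≤ 1) :
    ‖lastRowCLM (Module.finrank ℝ E) (krylovWeights M s)‖ ≤
      s * ∑ i : Fin (Module.finrank ℝ E), |charCoeff M i| := by
  refine (norm_lastRowCLM_le _ _).trans ?_
  rw [Finset.mul_sum]
  refine Finset.sum_le_sum fun i _ => ?_
  rw [krylovWeights, abs_mul, abs_neg, mul_comm s]
  refine mul_le_mul_of_nonneg_left ?_ (abs_nonneg _)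
  rw [abs_of_nonneg (pow_nonneg hs _)]
  calc s ^ (Module.finrank ℝ E - i) ≤ s ^ 1 :=
        pow_le_pow_of_le_one hs hs1 (by have := i.isLt; omega)
    _ = s := pow_one s


end Krylov

end Summit.AtomisticToContinuum.FouriersLaw.Theorems.ExtensiveSnapshotIrreversibility.EnergyWindow
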